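import Mathlib.Analysis.Normed.Field.Basic
import Mathlib.Topology.Algebra.Polynomial
import Literature.Computability.AlgebraicComplexity.StrassenMinimalBorderRank
import HarnessLib

/-!
# A tensor of border rank `≤ r` is a limit of tensors of rank `≤ r`

The elementary ("easy") half of the topological characterisation of border rank
(Bürgisser–Clausen–Shokrollahi 1997, §15.4 p. 419: "a tensor `t ∈ ℂ^{m×n×p}` of rank `r` may be
the limit of a sequence of tensors … of rank strictly smaller than `r`", the motivation of the
`k[ε]`-border rank of Def. (15.19); the inclusion `{R̲ ≤ r} ⊆ \overline{S_r}` of Alder's theorem,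
Thm. (20.3)), PROVED for the tree's algebraic border rank `algBorderRank` (Bläser Def. 6.1,
`SchoenhageTau.lean`) over any nontrivially normed field (`ℝ`, `ℂ`, `ℚ_p`, …), classical = product
topology on `ι → κ → μ → 𝕜`:

* `mem_closure_setOf_tensorRank_le_of_algBorderRank_le` — if `algBorderRank t ≤ r` then
  `t ∈ closure {s | tensorRank s ≤ r}`: take an order-`h` approximate decomposition
  `∑_ρ u_ρ(ε) ⊗ v_ρ(ε) ⊗ w_ρ(ε) = ε^h t + O(ε^{h+1})` with `r` triads
  (`exists_isApproxDecomposition_of_approxRank_le`), evaluate at `ε ≠ 0` and divide the first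
  factor by `ε^h`: these rank-`≤ r` tensors tend to `t` as `ε → 0`.

The converse inclusion over `ℂ` is Alder's theorem proper (BCS Thm. (20.3), the named fact
`BCS1997_thm_20_3` of `AlderSecantVariety.lean`); the two are combined in
`AlderTheoremEuclidean.lean`.
-/

noncomputable section

open scoped Polynomial Topology
open Filter

namespace Literature.Computability.AlgebraicComplexity

/-! ### Border rank `≤ r` ⟹ classical limit of rank-`≤ r` tensors (elementary, fact-free) -/

section Limit

variable {𝕜 : Type*} [NontriviallyNormedField 𝕜] {ι κ μ : Type*} [Fintype ι] [Fintype κ]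
  [Fintype μ] [DecidableEq ι] [DecidableEq κ] [DecidableEq μ]

/-- **A tensor of border rank `≤ r` is a limit of tensors of rank `≤ r`** (over `ℝ`, `ℂ` or any
nontrivially normed field; classical = product topology): if `∑_ρ u_ρ(ε) ⊗ v_ρ(ε) ⊗ w_ρ(ε) =
ε^h t + O(ε^{h+1})` with `r` triads over `𝕜[ε]`, then for `ε ≠ 0` the tensors
`ε^{-h} ∑_ρ u_ρ(ε) ⊗ v_ρ(ε) ⊗ w_ρ(ε)` have rank `≤ r` and tend to `t` as `ε → 0` (BCS §15.4,
p. 419; the elementary inclusion `{R̲ ≤ r} ⊆ closure {R ≤ r}` behind Thm. (20.3)). [folklore] -/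
theorem mem_closure_setOf_tensorRank_le_of_algBorderRank_le {t : ι → κ → μ → 𝕜} {r : ℕ}
    (ht : algBorderRank t ≤ r) : t ∈ closure {s : ι → κ → μ → 𝕜 | tensorRank s ≤ r} := by
  -- the border rank is attained at some order `h`, with exactly `r` triads
  obtain ⟨h, hh⟩ := Nat.sInf_mem (Set.range_nonempty fun h : ℕ => approxRank h t)
  have hhr : approxRank h t ≤ r := by
    have hb : algBorderRank t = approxRank h t := hh.symm
    exact hb ▸ ht
  obtain ⟨u, v, w, hd⟩ := exists_isApproxDecomposition_of_approxRank_le hhr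
  -- entrywise `F_abc = ∑_ρ u v w = X^h * Q_abc` with `Q_abc(0) = t_abc`
  set F : ι → κ → μ → 𝕜[X] := fun a b c => ∑ ρ, u ρ a * v ρ b * w ρ c with hF
  have hdvd : ∀ a b c, Polynomial.X ^ h ∣ F a b c := by
    intro a b c
    rw [Polynomial.X_pow_dvd_iff]
    intro d hd'
    have := hd a b c d hd'.le
    rw [if_neg hd'.ne] at this
    exact this
  choose Q hQ using hdvd
  have hQ0 : ∀ a b c, (Q a b c).coeff 0 = t a b c := by
    intro a b c
    have h1 := hd a b c h le_rfl
    rw [if_pos rfl] at h1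
    have h2 : (F a b c).coeff h = (Q a b c).coeff 0 := by
      rw [hQ a b c, Polynomial.coeff_X_pow_mul', if_pos le_rfl, Nat.sub_self]
    rw [← h2, ← h1]
  -- the family `ε ↦ (Q_abc(ε))_{abc}` tends to `t` and consists of rank-`≤ r` tensors for `ε ≠ 0`
  set s : 𝕜 → ι → κ → μ → 𝕜 := fun ε a b c => (Q a b c).eval ε with hs
  have hlim : Tendsto s (𝓝[≠] 0) (𝓝 t) := by
    refine tendsto_pi_nhds.mpr fun a => tendsto_pi_nhds.mpr fun b =>
      tendsto_pi_nhds.mpr fun c => ?_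
    have hc : Tendsto (fun ε : 𝕜 => (Q a b c).eval ε) (𝓝 0) (𝓝 ((Q a b c).eval 0)) :=
      (Q a b c).continuous.tendsto 0
    rw [← Polynomial.coeff_zero_eq_eval_zero, hQ0 a b c] at hc
    exact hc.mono_left nhdsWithin_le_nhds
  have hmem : ∀ᶠ ε in 𝓝[≠] (0 : 𝕜), s ε ∈ {s : ι → κ → μ → 𝕜 | tensorRank s ≤ r} := by
    refine eventually_nhdsWithin_of_forall fun ε hε => ?_
    have hε' : (ε : 𝕜) ^ h ≠ 0 := pow_ne_zero h hε
    refine tensorRank_le_of_eq_sum (fun ρ a => (ε ^ h)⁻¹ * (u ρ a).eval ε)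
      (fun ρ b => (v ρ b).eval ε) (fun ρ c => (w ρ c).eval ε) ?_
    funext a b c
    rw [Finset.sum_apply, Finset.sum_apply, Finset.sum_apply]
    simp only [triad_apply, hs]
    have hFε : (F a b c).eval ε = ε ^ h * (Q a b c).eval ε := by
      rw [hQ a b c, Polynomial.eval_mul, Polynomial.eval_pow, Polynomial.eval_X]
    have hQε : (Q a b c).eval ε = (ε ^ h)⁻¹ * (F a b c).eval ε := by
      rw [hFε, ← mul_assoc, inv_mul_cancel₀ hε', one_mul]
    rw [hQε, hF]
    simp only [Polynomial.eval_finsetSum, Polynomial.eval_mul, Finset.mul_sum]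
    refine Finset.sum_congr rfl fun ρ _ => ?_
    ring
  exact mem_closure_of_tendsto hlim hmem

end Limit

end Literature.Computability.AlgebraicComplexity

end
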